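import Mathlib.MeasureTheory.Integral.Bochner.Basic
import Mathlib.MeasureTheory.Integral.Bochner.Set
import Mathlib.MeasureTheory.Function.LpSeminorm.CompareExp
import Mathlib.MeasureTheory.Function.LpSpace.Basic
import Mathlib.Analysis.SpecialFunctions.Pow.Real
import Mathlib.Analysis.SpecialFunctions.Sqrt
import Literature.MathematicalPhysics.KineticTheory.InfiniteChainDynamics
import HarnessLib

/-!
# Tools for the fixed-time `L²` locality of the infinite chain: splitting along a bad event

Topic `Literature/MathematicalPhysics/KineticTheory` (tools for `InfiniteChainL2Locality`, which
proves the fixed-time `L²(μ)` locality of the Buttà–Marchioro flow with a summable rate). Elementary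
measure theory and real arithmetic, isolated so that the main file stays short:

* §1 `integral_sub_sq_le_of_bound_off` — on a finite measure space, if `|f - g| ≤ b` off a
  measurable set `B` and `f⁴, g⁴ ∈ L¹`, then for every `θ > 0`,
  `∫ (f - g)² ≤ b² μ(univ) + θ(∫ f⁴ + ∫ g⁴) + 2θ⁻¹ μ(B)` (pointwise `2x² ≤ θx⁴ + θ⁻¹`); invariance
  of second and fourth moments under measure-preserving maps; Minkowski in the form
  `(∫ (u-v)²)^{1/2} ≤ (∫ u²)^{1/2} + (∫ v²)^{1/2}`; and the passage from the split
  bound to the rate (`sqrt_le_of_split`).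
* §2 the arithmetic of BM's thresholds: the level `N = n/(2c)` (`level_bounds`), the rate on the
  good event `O(n^{2d+1} 32^{-n})` (`good_rate_le`), and the tail exponent (`tail_exponent_bounds`).

Everything is proved; tagged `[folklore]`. No definitions, no named facts.
-/

noncomputable section

open MeasureTheory Filter Set Function
open scoped Topology ENNReal

namespace Literature.MathematicalPhysics.KineticTheory.HeatConduction

/-! ### §1 An elementary splitting of `∫ (f - g)²` along a bad event -/

/-- `2x² ≤ θ x⁴ + θ⁻¹` for `θ > 0`. [folklore] -/
theorem two_mul_sq_le_theta {x θ : ℝ} (hθ : 0 < θ) : 2 * x ^ 2 ≤ θ * x ^ 4 + θ⁻¹ := by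
  have h : 0 ≤ θ * (x ^ 2 - θ⁻¹) ^ 2 := by positivity
  have e : θ * (x ^ 2 - θ⁻¹) ^ 2 = θ * x ^ 4 + θ⁻¹ - 2 * x ^ 2 := by
    field_simp
    ring
  linarith [h, e]

/-- **Splitting `∫ (f - g)²` along a bad event.** On a finite measure space, if `|f - g| ≤ b` off
the measurable set `B` and `f⁴, g⁴ ∈ L¹`, then for every `θ > 0`,
`∫ (f - g)² ≤ b² μ(univ) + θ (∫ f⁴ + ∫ g⁴) + 2 θ⁻¹ μ(B)` (and the left side is integrable). [folklore] -/
theorem integral_sub_sq_le_of_bound_off {Ω : Type*} [MeasurableSpace Ω] {μ : Measure Ω}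
    [IsFiniteMeasure μ] {f g : Ω → ℝ} (hf : Measurable f) (hg : Measurable g)
    (hf4 : Integrable (fun ω => f ω ^ 4) μ) (hg4 : Integrable (fun ω => g ω ^ 4) μ) {B : Set Ω}
    (hB : MeasurableSet B) {b θ : ℝ} (hθ : 0 < θ) (hbound : ∀ ω, ω ∉ B → |f ω - g ω| ≤ b) :
    Integrable (fun ω => (f ω - g ω) ^ 2) μ ∧
      ∫ ω, (f ω - g ω) ^ 2 ∂μ ≤
        b ^ 2 * μ.real univ + θ * ((∫ ω, f ω ^ 4 ∂μ) + ∫ ω, g ω ^ 4 ∂μ) + 2 * θ⁻¹ * μ.real B := by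
  classical
  -- the pointwise majorant
  set M : Ω → ℝ := fun ω => b ^ 2 + θ * (f ω ^ 4 + g ω ^ 4) + 2 * θ⁻¹ * B.indicator (fun _ => (1 : ℝ)) ω
    with hM
  have hpt : ∀ ω, (f ω - g ω) ^ 2 ≤ M ω := by
    intro ω
    have h4 : 0 ≤ θ * (f ω ^ 4 + g ω ^ 4) := by positivity
    by_cases hω : ω ∈ B
    · have h1 := two_mul_sq_le_theta (x := f ω) hθ
      have h2 := two_mul_sq_le_theta (x := g ω) hθ
      have h3 : (f ω - g ω) ^ 2 ≤ 2 * f ω ^ 2 + 2 * g ω ^ 2 := by nlinarith [sq_nonneg (f ω + g ω)]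
      rw [hM]; dsimp only
      rw [indicator_of_mem hω]
      nlinarith [sq_nonneg b]
    · have h1 : (f ω - g ω) ^ 2 ≤ b ^ 2 := by
        have := hbound ω hω
        rw [← sq_abs]
        exact pow_le_pow_left₀ (abs_nonneg _) this 2
      rw [hM]; dsimp only
      rw [indicator_of_notMem hω]
      linarith
  have i2 : Integrable (fun ω => θ * (f ω ^ 4 + g ω ^ 4)) μ := (hf4.add hg4).const_mul θ
  have i3 : Integrable (fun ω => b ^ 2 + θ * (f ω ^ 4 + g ω ^ 4)) μ := (integrable_const _).add i2
  have i4 : Integrable (fun ω => 2 * θ⁻¹ * B.indicator (fun _ => (1 : ℝ)) ω) μ :=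
    ((integrable_const (1 : ℝ)).indicator hB).const_mul _
  have hMint : Integrable M μ := i3.add i4
  have hmeas : AEStronglyMeasurable (fun ω => (f ω - g ω) ^ 2) μ :=
    ((hf.sub hg).pow_const 2).aestronglyMeasurable
  have hint : Integrable (fun ω => (f ω - g ω) ^ 2) μ := by
    refine hMint.mono' hmeas (Eventually.of_forall fun ω => ?_)
    rw [Real.norm_of_nonneg (sq_nonneg _)]
    exact hpt ω
  refine ⟨hint, ?_⟩
  calc ∫ ω, (f ω - g ω) ^ 2 ∂μ ≤ ∫ ω, M ω ∂μ := integral_mono hint hMint hpt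
    _ = b ^ 2 * μ.real univ + θ * ((∫ ω, f ω ^ 4 ∂μ) + ∫ ω, g ω ^ 4 ∂μ) + 2 * θ⁻¹ * μ.real B := by
        rw [hM]
        dsimp only
        have hind : ∫ a, B.indicator (fun _ => (1 : ℝ)) a ∂μ = μ.real B := by
          rw [integral_indicator hB, setIntegral_const, smul_eq_mul, mul_one]
        rw [integral_add i3 i4, integral_add (integrable_const _) i2, integral_const_mul,
          integral_add hf4 hg4, integral_const_mul, hind, integral_const, smul_eq_mul]
        ring

/-- Fourth moments are invariant under a measure-preserving map. [folklore] -/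
theorem integral_pow_four_comp_eq {Ω : Type*} [MeasurableSpace Ω] {μ : Measure Ω} {S : Ω → Ω}
    (hS : MeasurePreserving S μ μ) {g : Ω → ℝ} (hg : Measurable g) :
    ∫ ω, g (S ω) ^ 4 ∂μ = ∫ ω, g ω ^ 4 ∂μ := by
  have h := integral_map hS.measurable.aemeasurable
    ((hg.pow_const 4).aestronglyMeasurable (μ := μ.map S))
  rw [hS.map_eq] at h
  exact h.symm

/-! ### §2 Arithmetic of the thresholds and rates -/

/-- The `L²` bound `(∫ (u - v)²)^{1/2} ≤ (∫ u²)^{1/2} + (∫ v²)^{1/2}` (Minkowski). [folklore] -/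
theorem sqrt_integral_sub_sq_le {Ω : Type*} [MeasurableSpace Ω] {μ : Measure Ω} {u v : Ω → ℝ}
    (hu : MemLp u 2 μ) (hv : MemLp v 2 μ) :
    Real.sqrt (∫ ω, (u ω - v ω) ^ 2 ∂μ) ≤ Real.sqrt (∫ ω, u ω ^ 2 ∂μ) + Real.sqrt (∫ ω, v ω ^ 2 ∂μ) := by
  have hconv : ∀ {w : Ω → ℝ}, MemLp w 2 μ → Real.sqrt (∫ ω, w ω ^ 2 ∂μ) = (eLpNorm w 2 μ).toReal := by
    intro w hw
    have h := hw.eLpNorm_eq_integral_rpow_norm (by norm_num) ENNReal.ofNat_ne_top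
    rw [h, ENNReal.toReal_ofReal (by positivity), Real.sqrt_eq_rpow]
    congr 1
    · refine integral_congr_ae (Eventually.of_forall fun σ => ?_)
      simp only [ENNReal.toReal_ofNat, Real.norm_eq_abs, Real.rpow_two, sq_abs]
    · norm_num
  have hdiff : MemLp (u - v) 2 μ := hu.sub hv
  have e1 : ∫ ω, (u ω - v ω) ^ 2 ∂μ = ∫ ω, (u - v) ω ^ 2 ∂μ := rfl
  rw [e1, hconv hdiff, hconv hu, hconv hv,
    ← ENNReal.toReal_add hu.eLpNorm_ne_top hv.eLpNorm_ne_top]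
  exact ENNReal.toReal_mono (ENNReal.add_ne_top.2 ⟨hu.eLpNorm_ne_top, hv.eLpNorm_ne_top⟩)
    (eLpNorm_sub_le hu.aestronglyMeasurable hv.aestronglyMeasurable one_le_two)

/-- Second moments are invariant under a measure-preserving map. [folklore] -/
theorem integral_sq_comp_eq' {Ω : Type*} [MeasurableSpace Ω] {μ : Measure Ω} {S : Ω → Ω}
    (hS : MeasurePreserving S μ μ) {g : Ω → ℝ} (hg : Measurable g) :
    ∫ ω, g (S ω) ^ 2 ∂μ = ∫ ω, g ω ^ 2 ∂μ := by
  have h := integral_map hS.measurable.aemeasurable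
    ((hg.pow_const 2).aestronglyMeasurable (μ := μ.map S))
  rw [hS.map_eq] at h
  exact h.symm

/-- From the split bound to the rate: if `I ≤ b² + η(M + M) + 2η⁻¹ m`, `m ≤ K η²`, `b ≤ b'`, then
`√I ≤ b' + √(2(M + K)) √η`. [folklore] -/
theorem sqrt_le_of_split {I b b' η M K m : ℝ} (hb : 0 ≤ b) (hbb' : b ≤ b') (hη : 0 < η) (hM : 0 ≤ M)
    (hK : 0 ≤ K) (hm : m ≤ K * η ^ 2) (hI : I ≤ b ^ 2 + η * (M + M) + 2 * η⁻¹ * m) :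
    Real.sqrt I ≤ b' + Real.sqrt (2 * (M + K)) * Real.sqrt η := by
  have hb' : 0 ≤ b' := hb.trans hbb'
  have h1 : b ^ 2 ≤ b' ^ 2 := pow_le_pow_left₀ hb hbb' 2
  have h2 : 2 * η⁻¹ * m ≤ 2 * K * η := by
    calc 2 * η⁻¹ * m ≤ 2 * η⁻¹ * (K * η ^ 2) := mul_le_mul_of_nonneg_left hm (by positivity)
      _ = 2 * K * η := by field_simp
  have hI' : I ≤ b' ^ 2 + 2 * (M + K) * η := by nlinarith
  -- `√(x + y) ≤ √x + √y`
  have hsub : ∀ {x y : ℝ}, 0 ≤ x → 0 ≤ y → Real.sqrt (x + y) ≤ Real.sqrt x + Real.sqrt y := by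
    intro x y hx hy
    rw [Real.sqrt_le_left (by positivity)]
    nlinarith [Real.sq_sqrt hx, Real.sq_sqrt hy, Real.sqrt_nonneg x, Real.sqrt_nonneg y]
  calc Real.sqrt I ≤ Real.sqrt (b' ^ 2 + 2 * (M + K) * η) := Real.sqrt_le_sqrt hI'
    _ ≤ Real.sqrt (b' ^ 2) + Real.sqrt (2 * (M + K) * η) := hsub (by positivity) (by positivity)
    _ = b' + Real.sqrt (2 * (M + K)) * Real.sqrt η := by
        rw [Real.sqrt_sq hb', Real.sqrt_mul (by positivity)]

/-- **The level `N = n/(2c)`**: for `c ≥ 1`, `A τ²(1+τ) ≤ c`, `n ≥ 8 + 2A`, `n ≥ 2c`: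
`1 ≤ N ≤ n` and the deterministic threshold `4 + A(1 + τ²(1+τ)N) ≤ n` holds. [folklore] -/
theorem level_bounds {A c τ : ℝ} {n : ℕ} (hc1 : 1 ≤ c) (hAτ : A * (τ ^ 2 * (1 + τ)) ≤ c)
    (hn1 : 8 + 2 * A ≤ (n : ℝ)) (hn2 : 2 * c ≤ (n : ℝ)) :
    1 ≤ (n : ℝ) / (2 * c) ∧ (n : ℝ) / (2 * c) ≤ n ∧
      4 + A * (1 + τ ^ 2 * (1 + τ) * ((n : ℝ) / (2 * c))) ≤ n := by
  have hc0 : 0 < c := by linarith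
  set N : ℝ := (n : ℝ) / (2 * c) with hN
  have h2cN : 2 * c * N = n := by rw [hN]; field_simp
  have hN1 : 1 ≤ N := by rw [hN, le_div_iff₀ (by positivity)]; linarith
  have hN0 : 0 ≤ N := by linarith
  have hNle : N ≤ n := by
    have : N * 1 ≤ N * (2 * c) := mul_le_mul_of_nonneg_left (by linarith) hN0
    linarith
  refine ⟨hN1, hNle, ?_⟩
  have h1 : A * (τ ^ 2 * (1 + τ)) * N ≤ c * N := mul_le_mul_of_nonneg_right hAτ hN0
  have h2 : A * (1 + τ ^ 2 * (1 + τ) * N) = A + A * (τ ^ 2 * (1 + τ)) * N := by ring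
  rw [h2]
  linarith

/-- **The rate on the good event**: with `N ≤ n`, `n ≥ 1`, `δ = (2 + 22τKN) 32^{-(n-1)}`,
`δ ≤ (2 + 22τK n)·32·32^{-n}` and `Ca (L N (2n+7))^{d} δ ≤ 32 Ca (9L)^d (2+22τK) n^{2d+1} 32^{-n}`. [folklore] -/
theorem good_rate_le {Ca L K τ N : ℝ} {da n : ℕ} (hCa : 0 ≤ Ca) (hL : 0 ≤ L) (hK : 0 ≤ K)
    (hτ : 0 ≤ τ) (hN0 : 0 ≤ N) (hNle : N ≤ n) (hn1 : (1 : ℝ) ≤ n) :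
    (2 + 22 * τ * K * N) * ((1 : ℝ) / 32) ^ (n - 1) ≤ (2 + 22 * τ * K * n) * 32 * ((1 : ℝ) / 32) ^ n ∧
      Ca * (L * N * (2 * n + 7)) ^ da * ((2 + 22 * τ * K * N) * ((1 : ℝ) / 32) ^ (n - 1)) ≤
        (32 * Ca * (9 * L) ^ da * (2 + 22 * τ * K)) * (n : ℝ) ^ (2 * da + 1) * ((1 : ℝ) / 32) ^ n := by
  have hnn : (0 : ℝ) ≤ n := by linarith
  have hτK : 0 ≤ 22 * τ * K := by positivity
  have hpow : ((1 : ℝ) / 32) ^ (n - 1) = 32 * ((1 : ℝ) / 32) ^ n := by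
    obtain ⟨k, hk⟩ : ∃ k, n = k + 1 := ⟨n - 1, by
      have : 1 ≤ n := by exact_mod_cast hn1
      omega⟩
    rw [hk, Nat.add_sub_cancel, pow_succ]
    ring
  have hr0 : (0 : ℝ) ≤ 32 * ((1 : ℝ) / 32) ^ n := by positivity
  have hδle : (2 + 22 * τ * K * N) * ((1 : ℝ) / 32) ^ (n - 1) ≤
      (2 + 22 * τ * K * n) * 32 * ((1 : ℝ) / 32) ^ n := by
    rw [hpow]
    have h1 : 2 + 22 * τ * K * N ≤ 2 + 22 * τ * K * n := by
      have := mul_le_mul_of_nonneg_left hNle hτK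
      linarith
    calc (2 + 22 * τ * K * N) * (32 * ((1 : ℝ) / 32) ^ n)
        ≤ (2 + 22 * τ * K * n) * (32 * ((1 : ℝ) / 32) ^ n) := mul_le_mul_of_nonneg_right h1 hr0
      _ = (2 + 22 * τ * K * n) * 32 * ((1 : ℝ) / 32) ^ n := by ring
  refine ⟨hδle, ?_⟩
  have hδ0 : 0 ≤ (2 + 22 * τ * K * N) * ((1 : ℝ) / 32) ^ (n - 1) := by positivity
  have h1 : L * N * (2 * n + 7) ≤ 9 * L * ((n : ℝ) * n) := by
    have h2 : N * (2 * n + 7) ≤ n * (9 * n) := mul_le_mul hNle (by linarith) (by positivity) hnn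
    have h3 := mul_le_mul_of_nonneg_left h2 hL
    calc L * N * (2 * n + 7) = L * (N * (2 * n + 7)) := by ring
      _ ≤ L * (n * (9 * n)) := h3
      _ = 9 * L * ((n : ℝ) * n) := by ring
  have h1' : (L * N * (2 * n + 7)) ^ da ≤ (9 * L) ^ da * (n : ℝ) ^ (2 * da) := by
    calc (L * N * (2 * n + 7)) ^ da ≤ (9 * L * ((n : ℝ) * n)) ^ da :=
          pow_le_pow_left₀ (by positivity) h1 da
      _ = (9 * L) ^ da * (n : ℝ) ^ (2 * da) := by rw [mul_pow, pow_mul, sq]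
  have h3 : (2 + 22 * τ * K * N) * ((1 : ℝ) / 32) ^ (n - 1) ≤
      (2 + 22 * τ * K) * n * (32 * ((1 : ℝ) / 32) ^ n) := by
    refine hδle.trans ?_
    have h4 : (2 + 22 * τ * K * n) ≤ (2 + 22 * τ * K) * n := by
      have h5 : (2 : ℝ) ≤ 2 * n := by linarith
      have h6 : (2 + 22 * τ * K) * n = 2 * n + 22 * τ * K * n := by ring
      rw [h6]; linarith
    calc (2 + 22 * τ * K * n) * 32 * ((1 : ℝ) / 32) ^ n
        = (2 + 22 * τ * K * n) * (32 * ((1 : ℝ) / 32) ^ n) := by ring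
      _ ≤ (2 + 22 * τ * K) * n * (32 * ((1 : ℝ) / 32) ^ n) := mul_le_mul_of_nonneg_right h4 hr0
  have h5 : 0 ≤ (9 * L) ^ da * (n : ℝ) ^ (2 * da) := by positivity
  calc Ca * (L * N * (2 * n + 7)) ^ da * ((2 + 22 * τ * K * N) * ((1 : ℝ) / 32) ^ (n - 1))
      ≤ Ca * ((9 * L) ^ da * (n : ℝ) ^ (2 * da)) * ((2 + 22 * τ * K) * n * (32 * ((1 : ℝ) / 32) ^ n)) :=
        mul_le_mul (mul_le_mul_of_nonneg_left h1' hCa) h3 hδ0 (mul_nonneg hCa h5)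
    _ = (32 * Ca * (9 * L) ^ da * (2 + 22 * τ * K)) * (n : ℝ) ^ (2 * da + 1) * ((1 : ℝ) / 32) ^ n := by
        rw [pow_succ]; ring

/-- **The tail exponent**: with `2c N = n`, `c > 0`, `λ₀ > 0` and `n ≥ 2c(C_ω + 3/2)/λ₀`:
`3/2 ≤ λ₀ N - C_ω`, and `√(e^{-(λ₀N - C_ω)/2}) ≤ e^{C_ω/4} (e^{-λ₀/(8c)})^n`. [folklore] -/
theorem tail_exponent_bounds {c Cω lam₀ N : ℝ} {n : ℕ} (hc0 : 0 < c) (hlam₀ : 0 < lam₀)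
    (h2cN : 2 * c * N = n) (hn : 2 * c * (Cω + 3 / 2) / lam₀ ≤ n) :
    3 / 2 ≤ lam₀ * N - Cω ∧
      Real.sqrt (Real.exp (-(lam₀ * N - Cω) / 2)) ≤
        Real.exp (Cω / 4) * Real.exp (-(lam₀ / (8 * c))) ^ n := by
  have h1 : 2 * c * (Cω + 3 / 2) ≤ lam₀ * n := by
    rw [div_le_iff₀ hlam₀] at hn; linarith
  rw [← h2cN] at h1
  have h2 : 2 * c * (Cω + 3 / 2) ≤ 2 * c * (lam₀ * N) := by linarith
  have h3 : Cω + 3 / 2 ≤ lam₀ * N := le_of_mul_le_mul_left h2 (by positivity)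
  refine ⟨by linarith, ?_⟩
  have e1 : Real.sqrt (Real.exp (-(lam₀ * N - Cω) / 2)) = Real.exp (-(lam₀ * N - Cω) / 4) := by
    rw [Real.sqrt_eq_rpow, ← Real.exp_mul]; congr 1; ring
  have e2 : Real.exp (Cω / 4) * Real.exp (-(lam₀ / (8 * c))) ^ n =
      Real.exp (Cω / 4 - lam₀ / (8 * c) * n) := by
    rw [← Real.exp_nat_mul, ← Real.exp_add]; congr 1; ring
  rw [e1, e2, Real.exp_le_exp]
  have h4 : lam₀ / (8 * c) * n = lam₀ * N / 4 := by
    rw [← h2cN]; field_simp; ring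
  rw [h4]; linarith

end Literature.MathematicalPhysics.KineticTheory.HeatConduction

end
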